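import Summits.Ventures.PercRepro.CrossTermPlus

/-!
# PercRepro — PARALLEL substitution for the marked-partition law and for `Q⁺(Δ_g, Δ_g)` (typer-2, gen 4)

`LEAD-C011-concavity.md` §10.13 and ASSIGNMENTS v25 (L2), parallel half: two parallel edges of
weights `p₁, p₂` are seen by the marked partition only through «at least one is open», so they may
be replaced by ONE edge of weight `1 − (1 − p₁)(1 − p₂)`. An identity of the law `law4` for every
`p`, hence of `deltaQuad` along any edge `g` outside the pair (**`deltaQuad_parallel`**). The series
half (an unmarked vertex of degree two) is `Series.lean`.

* `conn_congr_of_openAdj_iff`, `mem_partitionEvent_congr` — connectivity-determined events;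
* `Parallel e₁ e₂`, `openAdj_update_iff_of_parallel`, `conn_update_iff_of_parallel`;
* `parWeight p e₁ e₂ = p[e₂ := 0][e₁ := 1 − (1 − p₁)(1 − p₂)]`, `parWeight_update`;
* **`prob_partitionEvent_parallel`** (conditioning on the pair + flip transport), `law4_parallel`,
  **`deltaQuad_parallel`**.
-/

namespace PercRepro

namespace MultiGraph

variable {V E : Type*} (G : MultiGraph V E)

/-! ### Connectivity-determined events -/

/-- Connectivity is a congruence of open adjacency. -/
theorem conn_congr_of_openAdj_iff {ω ω' : Config E}
    (h : ∀ x y, G.OpenAdj ω x y ↔ G.OpenAdj ω' x y) (x y : V) :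
    G.Conn ω x y ↔ G.Conn ω' x y :=
  ⟨fun hc => Relation.ReflTransGen.mono (fun a b hab => (h a b).mp hab) x y hc,
    fun hc => Relation.ReflTransGen.mono (fun a b hab => (h a b).mpr hab) x y hc⟩

/-- Membership in a partition row depends only on the connectivity relation. -/
theorem mem_partitionEvent_congr {ω ω' : Config E} (h : ∀ x y, G.Conn ω x y ↔ G.Conn ω' x y)
    {k : ℕ} (m : Fin k → V) (rgs : Fin k → ℕ) :
    ω ∈ G.partitionEvent m rgs ↔ ω' ∈ G.partitionEvent m rgs := by
  simp only [partitionEvent, Set.mem_setOf_eq, h]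

/-! ### Parallel edges -/

/-- Two edges are PARALLEL: the same two endpoints, in either order. -/
def Parallel (e₁ e₂ : E) : Prop :=
  (G.fst e₁ = G.fst e₂ ∧ G.snd e₁ = G.snd e₂) ∨ (G.fst e₁ = G.snd e₂ ∧ G.snd e₁ = G.fst e₂)

/-- Parallelism is symmetric. -/
theorem Parallel.symm {e₁ e₂ : E} (h : G.Parallel e₁ e₂) : G.Parallel e₂ e₁ := by
  rcases h with ⟨h1, h2⟩ | ⟨h1, h2⟩
  · exact Or.inl ⟨h1.symm, h2.symm⟩
  · exact Or.inr ⟨h2.symm, h1.symm⟩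

/-- Parallel edges have the same endpoint pairs. -/
theorem Parallel.endpoints_iff {e₁ e₂ : E} (h : G.Parallel e₁ e₂) (x y : V) :
    ((G.fst e₁ = x ∧ G.snd e₁ = y) ∨ (G.fst e₁ = y ∧ G.snd e₁ = x)) ↔
      ((G.fst e₂ = x ∧ G.snd e₂ = y) ∨ (G.fst e₂ = y ∧ G.snd e₂ = x)) := by
  rcases h with ⟨h1, h2⟩ | ⟨h1, h2⟩
  · rw [h1, h2]
  · rw [h1, h2]
    constructor
    · rintro (⟨h3, h4⟩ | ⟨h3, h4⟩)
      · exact Or.inr ⟨h4, h3⟩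
      · exact Or.inl ⟨h4, h3⟩
    · rintro (⟨h3, h4⟩ | ⟨h3, h4⟩)
      · exact Or.inr ⟨h4, h3⟩
      · exact Or.inl ⟨h4, h3⟩

variable [DecidableEq E]

/-- When a parallel edge `e₂` is open, the state of `e₁` does not change open adjacency. -/
theorem openAdj_update_iff_of_parallel {e₁ e₂ : E} (hne : e₁ ≠ e₂) (hpar : G.Parallel e₁ e₂)
    {ω : Config E} (h₂ : ω e₂ = true) (b : Bool) (x y : V) :
    G.OpenAdj (Function.update ω e₁ b) x y ↔ G.OpenAdj ω x y := by
  constructor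
  · rintro ⟨e, he, hend⟩
    by_cases hee : e = e₁
    · subst hee
      exact ⟨e₂, h₂, (hpar.endpoints_iff G x y).mp hend⟩
    · rw [Function.update_of_ne hee] at he
      exact ⟨e, he, hend⟩
  · rintro ⟨e, he, hend⟩
    by_cases hee : e = e₁
    · subst hee
      refine ⟨e₂, ?_, (hpar.endpoints_iff G x y).mp hend⟩
      rw [Function.update_of_ne hne.symm]
      exact h₂
    · refine ⟨e, ?_, hend⟩
      rw [Function.update_of_ne hee]
      exact he

/-- When a parallel edge `e₂` is open, the state of `e₁` does not change connectivity. -/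
theorem conn_update_iff_of_parallel {e₁ e₂ : E} (hne : e₁ ≠ e₂) (hpar : G.Parallel e₁ e₂)
    {ω : Config E} (h₂ : ω e₂ = true) (b : Bool) (x y : V) :
    G.Conn (Function.update ω e₁ b) x y ↔ G.Conn ω x y :=
  G.conn_congr_of_openAdj_iff (fun x y => G.openAdj_update_iff_of_parallel hne hpar h₂ b x y) x y

end MultiGraph

/-- The PARALLEL substitution weights: `e₂` deleted, `e₁` of weight `1 − (1 − p₁)(1 − p₂)`. -/
noncomputable def parWeight {E : Type*} [DecidableEq E] (p : E → ℝ) (e₁ e₂ : E) : E → ℝ :=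
  Function.update (Function.update p e₂ 0) e₁ (1 - (1 - p e₁) * (1 - p e₂))

/-- The parallel substitution commutes with fixing the weight of an edge outside the pair. -/
theorem parWeight_update {E : Type*} [DecidableEq E] (p : E → ℝ) {e₁ e₂ g : E}
    (hg₁ : g ≠ e₁) (hg₂ : g ≠ e₂) (t : ℝ) :
    parWeight (Function.update p g t) e₁ e₂ = Function.update (parWeight p e₁ e₂) g t := by
  unfold parWeight
  rw [Function.update_of_ne hg₁.symm, Function.update_of_ne hg₂.symm,
    Function.update_comm hg₂ t 0 p,
    Function.update_comm hg₁ t (1 - (1 - p e₁) * (1 - p e₂)) (Function.update p e₂ 0)]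

namespace MultiGraph

variable {V E : Type*} (G : MultiGraph V E) [Fintype E] [DecidableEq E]

/-- **Parallel substitution for the partition law**: two parallel edges of weights `p₁, p₂` are one
edge of weight `1 − (1 − p₁)(1 − p₂)`. -/
theorem prob_partitionEvent_parallel {e₁ e₂ : E} (hne : e₁ ≠ e₂) (hpar : G.Parallel e₁ e₂)
    (p : E → ℝ) {k : ℕ} (m : Fin k → V) (rgs : Fin k → ℕ) :
    prob p (G.partitionEvent m rgs) = prob (parWeight p e₁ e₂) (G.partitionEvent m rgs) := by
  set A := G.partitionEvent m rgs with hA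
  -- `e₂` open: the state of `e₁` is irrelevant
  have hQ1 : prob (Function.update (Function.update p e₂ 1) e₁ 1) A =
      prob (Function.update (Function.update p e₂ 1) e₁ 0) A := by
    rw [prob_update_one_eq_prob_update_zero_preimage]
    refine prob_congr_of_support _ fun ω hw => ?_
    have h₂ : ω e₂ = true := eq_true_of_weight_ne_zero_of_eq_one hw
      (by rw [Function.update_of_ne hne.symm, Function.update_self])
    rw [Set.mem_preimage, PercRepro.flipEdge]
    exact G.mem_partitionEvent_congr (G.conn_update_iff_of_parallel hne hpar h₂ _) m rgs
  -- `e₁` open: the state of `e₂` is irrelevant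
  have hQ2 : prob (Function.update (Function.update p e₂ 0) e₁ 1) A =
      prob (Function.update (Function.update p e₂ 1) e₁ 1) A := by
    rw [Function.update_comm hne.symm 0 1 p, Function.update_comm hne.symm 1 1 p,
      prob_update_zero_eq_prob_update_one_preimage]
    refine prob_congr_of_support _ fun ω hw => ?_
    have h₁ : ω e₁ = true := eq_true_of_weight_ne_zero_of_eq_one hw
      (by rw [Function.update_of_ne hne, Function.update_self])
    rw [Set.mem_preimage, PercRepro.flipEdge]
    exact G.mem_partitionEvent_congr (G.conn_update_iff_of_parallel hne.symm hpar.symm h₁ _) m rgs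
  have hL : prob p A = p e₂ * (p e₁ * prob (Function.update (Function.update p e₂ 1) e₁ 1) A +
      (1 - p e₁) * prob (Function.update (Function.update p e₂ 1) e₁ 0) A) +
      (1 - p e₂) * (p e₁ * prob (Function.update (Function.update p e₂ 0) e₁ 1) A +
      (1 - p e₁) * prob (Function.update (Function.update p e₂ 0) e₁ 0) A) := by
    rw [prob_split p e₂ A, prob_split (Function.update p e₂ 1) e₁ A,
      prob_split (Function.update p e₂ 0) e₁ A, Function.update_of_ne hne,
      Function.update_of_ne hne]
  have hR : prob (parWeight p e₁ e₂) A = (1 - (1 - p e₁) * (1 - p e₂)) *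
      prob (Function.update (Function.update p e₂ 0) e₁ 1) A +
      (1 - (1 - (1 - p e₁) * (1 - p e₂))) * prob (Function.update (Function.update p e₂ 0) e₁ 0) A := by
    rw [prob_split (parWeight p e₁ e₂) e₁ A]
    unfold parWeight
    rw [Function.update_idem, Function.update_idem, Function.update_self]
  rw [hL, hR, hQ2, hQ1]
  ring

/-- **Parallel substitution for the law `law4`.** -/
theorem law4_parallel {e₁ e₂ : E} (hne : e₁ ≠ e₂) (hpar : G.Parallel e₁ e₂) (p : E → ℝ)
    (a b c d : V) : G.law4 p a b c d = G.law4 (parWeight p e₁ e₂) a b c d :=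
  funext fun _ => G.prob_partitionEvent_parallel hne hpar p _ _

/-- **Parallel substitution for `Q⁺(Δ_g, Δ_g)`** along any edge `g` outside the pair. -/
theorem deltaQuad_parallel {e₁ e₂ : E} (hne : e₁ ≠ e₂) (hpar : G.Parallel e₁ e₂) (p : E → ℝ)
    {g : E} (hg₁ : g ≠ e₁) (hg₂ : g ≠ e₂) (a b c d : V) :
    G.deltaQuad p g a b c d = G.deltaQuad (parWeight p e₁ e₂) g a b c d := by
  unfold deltaQuad
  rw [G.law4_parallel hne hpar (Function.update p g 1), G.law4_parallel hne hpar
    (Function.update p g 0), parWeight_update p hg₁ hg₂, parWeight_update p hg₁ hg₂]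

end MultiGraph

end PercRepro
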